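import Literature.MathematicalPhysics.QuantumFieldTheory.Balaban1983to89.Node00.Record13CarriersXPinned
import Literature.MathematicalPhysics.QuantumFieldTheory.Balaban1983to89.Node00.Record13CarriersSepCoPH
import Literature.MathematicalPhysics.QuantumFieldTheory.Balaban1983to89.Node00.Record13CarriersB8SubBP2C
import Literature.MathematicalPhysics.QuantumFieldTheory.Balaban1983to89.Node00.CarriersB8SubBP2D

/-!
# NODE 00 (YM-PLAN Track A) — THE X-PINNED STAGE-13 PRESENTATION WITH THE [B8] GROUP AT THE «P₂D» PIN: `XPinned₁₃P₂D` ∕ `Stage13Params.pinX3P₂D` ∕ `Stage13HParams.pinX3P₂D`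
# = this seat's `XPinned₁₃P₂C` ∕ `pinX3P₂C` (`Node00/Record13CarriersXPinnedP2C`, p609862) with the ONE token `withB8OfRecordSubBP₂C ↦ withB8OfRecordSubBP₂D` (dag-n05-w1
# `Node00/CarriersB8SubBP2D`, p617069: the δ₂ group over the (1.5)-OBEYING admissible sub-index `IdxB8SubD` (`Node00/CarriersB8SubD`, p615695), Proposition 7's axial map
# PINNED to print's tower map at `j.1.1.1`), its `rfl` faces, the H-level lift at the v1.7 `CoPH` key with laws ∕ provisos ∕ datums, the K1 engine's three X-reading
# sockets AT THE P₂D-PIN, N05's socket IN THE REPAIRED CURRENCY (dag-n05-w1's SC-binding `upOfRecord₅CSC … (c₇OfRecord θ₃)`, `Node00/Record13CarriersB8SubBP2C` §0, REUSED;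
# `b8 ↔ B8LeafOfRecordSubBP₂D θ₃ lam8`, `Iff.rfl` — the slot dag-n05-d's re-keyed «P₂D» knits SERVE modulo the (1.5)-keyed [4]-type sockets only) and the v1.7 records
# presented at the P₂D-pin

«P₂D» IMAGE (width seat `pub-ymgap-dag-n05-w4` g3, 2026-08-28; token map «`SubBP₂C ↦ SubBP₂D`, `IdxB8SubC ↦ IdxB8SubD`, axial accessor `j.1.1 ↦ j.1.1.1`; surviving socket
`upOfRecord₅CSC … (c₇OfRecord θ₃)` UNCHANGED»; dag-n05-d g12 DESIGN WORD «P₂D» (cell bus 2026-08-28 07:54Z) ∕ dag-n05-c g15 CONCUR ∕ dag-n05-w1 g2 «records mine, X-view ∕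
engine twins n05-w4's» (bus 08:08Z ∕ 08:29Z ∕ 08:31Z); dag-lead DEDUP-376 «records∕storeys re-key (n05-w1∕w4, token swap)»).  APPEND-ONLY: a NEW importing module; NOTHING in
`Record13CarriersXPinned` (dag-n10-d), `Record13CarriersSepCoPH` ∕ `Record13CarriersCoPH` (dag-n10-d), `Record13CarriersB8SubBP2C` ∕ `CarriersB8SubBP2C` ∕ `CarriersB8SubBP2D` ∕
`CarriersB8SubD` (dag-n05-w1), `Record13CarriersXPinnedP2C` (this seat) or below them is edited — everything BY NAME.

WHY.  The honest N05 slot moved once more (dag-n05-w1 g2's kernel certificate `B8SockLettersRDIdxB8LawsBVacuity`, p613168: the [4]-letters binders of the «P₂C» knits,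
quantified over `Ω₀ = ℤᵈ ∧ IdxB8LawsB ∧ DomainSeq`, are UNSATISFIABLE as typed; repair letter = dag-n05-c g15's (1.5) corner reading `LamTop`, p613464): the slot every
printed member of [Balaban1985RegularSpaces] serves is now `B8LeafOfRecordSubBP₂D` (`B8LeafRSC` at `c₇OfRecord θ = 530·D·L²` over the (1.5)-obeying sub-index
`IdxB8SubD θ`), bound at records by `upOfRecord₅CSC`.  The K1 rung still needs ALL nodes at ONE world; THIS FILE gives the P₂D slot its four-pin X-view address
exactly as `Record13CarriersXPinnedP2C` did for the P₂C slot — and the SC-bound record over it (`Record13CarriersXPinnedP2DSViewCoPH`, next file) is a member of the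
`b8`-generic class `Node00/Record13SClassSepCoPHG` by `isRecordOfRecord₁₃CSepCoPHG_of_upSC_rebindX_view₁₃CoPHB10YZW`.

WHAT IS DEFINED ∕ PROVED (kernel bookkeeping, 0 sorry): §1 `XPinned₁₃P₂D`, `Stage13Params.pinX3P₂D` + the `rfl` ∕ `Iff.rfl` faces (`_eq_rebindX ∕ _res_X ∕ _S13 ∕ _c13 ∕ _F12 ∕ _c12 ∕
_toStage3Params ∕ _toStage12Params ∕ _L_γ ∕ _ε₂₉ ∕ _res_Y_Z_W ∕ _admissible_iff ∕ _guard_iff ∕ _histories`, `toStage5₁₃_pinX3P₂D`, `WOfRecord₁₃_pinX3P₂D`, `F12OfRecord₁₂_pinX3P₂D`); §2 sockets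
`socket05_pinX3P₂D_iff` (typed leaf over `IdxB8SubD`, axial map pinned at `j.1.1.1`), `socket09_pinX3P₂D_iff`, `socket10_pinX3P₂D_iff`, `socket10_pinX3P₂D_of_leafOfRecord`; §3 (H) the
H-LIFT `Stage13HParams.pinX3P₂D` + `_eq_rebindX ∕ _toStage13Params` (+ `Zh`) ∕ `_faces` ∕ `_admissible_iff ∕ _guard_iff`, `Provisos₁₃CoPH.pinX3P₂D`, `toStage5₁₃CoPH_pinX3P₂D`,
`pinX3P₂D_lawsCoPH`, `Provisos₁₃SepCoPH.pinX3P₂D`, `datumOfRecord₁₃CoPH_pinX3P₂D`, `datumOfRecord₁₃SepCoPH_pinX3P₂D`; §4 ★ `socket05SC_toStage5₁₃CoPH_pinX3P₂D_iff` (`b8 ↔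
B8LeafOfRecordSubBP₂D θ₃ lam8` under `upOfRecord₅CSC`, `Iff.rfl`), `socket05_toStage5₁₃CoPH_pinX3P₂D_iff`, `b8SC_of_b8_toStage5₁₃CoPH_pinX3P₂D` (typed ⇒ RS ⇒ slot, from admissibility,
via dag-n05-w1's `b8LeafOfRecordSubBP₂D_of_b8LeafRS_pinned` under `C136_C162_famB8OfRecordSubBP₂D`), `upOfRecord₅CSC_toStage5₁₃CoPH_pinX3P₂D_offB8` (`rfl` ×5); §5
`isRecordOfRecord₁₃CCoPH_pinX3P₂D_of_eq`, `isRecordOfRecord₁₃CSepCoPH_pinX3P₂D_of_eq`, `exists_world_isRecordOfRecord₁₃CSepCoPH_pinX3P₂D` (C-binding records).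
HONEST FRAMING: definitions + kernel bookkeeping; NO estimate; nothing of Bałaban's asserted; whether the slot is SERVED is the knits' business (dag-n05-d's re-keyed «P₂D»
knits, modulo the (1.5)-keyed [4]-type sockets ∕ letters at the (1.3)–(1.5)-admissible `Ω₀ = ℤᵈ` law members — N06 content, m ≥ 1 OPEN); Proposition 7 in the repaired
currency is WEAKER than print's `2α₂` (declared by the pin, WATCH-P7-CURRENCY-RECORD); N05 NOT discharged; K1 NOT claimed; counts unmoved; count-neutral; one finite T⁴
programme at fixed ε — NOT continuum ∕ ℝ⁴ ∕ OS ∕ mass gap ∕ Clay.  No `sorry`, no `axiom`, no `instance`, no `notation`.  Unit `pub-ymgap-dag-n05-w4` (g3), 2026-08-28.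
[Balaban1985RegularSpaces] = Commun. Math. Phys. **99** (1985) 75–102; [Balaban1989LargeFieldII] = Commun. Math. Phys. **122** (1989) 355–392; [Balaban1988Convergent] = Commun.
Math. Phys. **119** (1988) 243–285; [Balaban1987RG1] = Commun. Math. Phys. **109** (1987) 249–301; [Balaban1988RG2Cluster] = Commun. Math. Phys. **116** (1988) 1–22.
-/


noncomputable section

namespace Literature.MathematicalPhysics.QuantumFieldTheory.Balaban1983to89.Node00

open T4Continuum AveragingRT FlowStep FlowStepRuns DagBinding T4DatumAssembly
open B8IdxB8LawsB (IdxB8SubB famB8OfRecordSubB)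
open B8Prop7TowerAxialRecord (toAxialTowerResid)
open scoped Matrix.Norms.L2Operator

variable (F : T4Family) (N : ℕ) [NeZero N]

/-! ## §1. The combined carrier map WITH THE [B8] GROUP AT THE «P₂D» PIN and the one-level θ-pin; faces as instances of the generic `rebindX` faces -/

section PinX3

variable (θ : Stage13Params F N) (lam8 : ResidB8 θ.toStage3Params) (lam12 : ResidB12 F N θ.τ9.M)
  (lam13 : B12.RunParams → ResidB13 θ.toStage3Params)

/-- **THE X-PINNED CARRIER FAMILY OF RECORD**, run `P`: `θ`'s residual bundle with its [B8] group := the four-law group of record at `lam8` READ AT THE δ₂-MEMBERS OVER THE (1.5)-OBEYING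
ADMISSIBLE SUB-INDEX (`withB8OfRecordSubBP₂D`, dag-n05-w1 `Node00/CarriersB8SubBP2D` — the ONE token by which this file differs from `XPinned₁₃P₂C` ∕ `XPinned₁₃P`, dag-n05-d's `XPinned₁₃H` and dag-n10-d's
`XPinned₁₃`), its [B12] group := node00-def g32's frame of record `F12OfRecord₁₂ θ.toStage12Params lam12 P` with constants `(lam12 P).consts` (`withB12`), and its
[B13] group := node00-def-B13's group of record at `lam13 P` (`withB13OfRecord`) — three field-disjoint substitutions of one `PrintedCarriersR`.
[cite: Balaban1985RegularSpaces, Thm 2 p.83; Balaban1987RG1, Lemma 4 p.280; Balaban1988RG2Cluster, Lemmas 1–3 pp.9–20 (objects of record, Stage 3′(X))] -/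
def XPinned₁₃P₂D : B12.RunParams → PrintedCarriersR := fun P =>
  (((θ.res.X P).withB8OfRecordSubBP₂D θ.toStage3Params lam8).withB12 (F12OfRecord₁₂ F N θ.toStage12Params lam12 P) (lam12 P).consts).withB13OfRecord
    θ.toStage3Params (lam13 P)

/-- **THE X-PINNED STAGE-13 PARAMETER** `θ.pinX3P₂D lam8 lam12 lam13 := θ.rebindX (XPinned₁₃P₂D θ lam8 lam12 lam13)` — ONE re-binding (definitionally the by-hand chain
`((θ.pinB8SubBP₂D lam8).pinB12 lam12).pinB13 lam13` once dag-n05-w1's one-pin record lands, an equation deliberately not recorded: it is the nested comparison that exhausts 10⁶ heartbeats).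
[cite: Balaban1988Convergent, p.244; Balaban1989LargeFieldII, Thm 1 p.355 (bookkeeping presentation)] -/
def Stage13Params.pinX3P₂D : Stage13Params F N := θ.rebindX F N (XPinned₁₃P₂D F N θ lam8 lam12 lam13)

/-- Unfolding (`rfl`). [cite: Balaban1988Convergent, p.244 (bookkeeping)] -/
theorem Stage13Params.pinX3P₂D_eq_rebindX : θ.pinX3P₂D F N lam8 lam12 lam13 = θ.rebindX F N (XPinned₁₃P₂D F N θ lam8 lam12 lam13) := rfl

/-- The pinned carrier family IS the combined map (`rfl`, `Record13Carriers.Stage13Params.rebindX_res_X`). [cite: Balaban1988Convergent, p.244 (bookkeeping)] -/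
theorem Stage13Params.pinX3P₂D_res_X (P : B12.RunParams) : (θ.pinX3P₂D F N lam8 lam12 lam13).res.X P = XPinned₁₃P₂D F N θ lam8 lam12 lam13 P := rfl

/-- **Its [B13] step IS the step of record** (`rfl`). [cite: Balaban1988RG2Cluster, (1.33) p.9 and Lemmas 1–3 (objects of record)] -/
theorem Stage13Params.pinX3P₂D_S13 (P : B12.RunParams) :
    ((θ.pinX3P₂D F N lam8 lam12 lam13).res.X P).S13 = (WtOfRecord θ.toStage3Params (lam13 P)).toStepData := rfl

/-- **Its [B13] constants ARE the constants of record** (`rfl`). [cite: Balaban1988RG2Cluster, Lemmas 1–3 pp.9–20 (bookkeeping)] -/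
theorem Stage13Params.pinX3P₂D_c13 (P : B12.RunParams) : ((θ.pinX3P₂D F N lam8 lam12 lam13).res.X P).c13 = c13OfRecord θ.toStage3Params (lam13 P) := rfl

/-- **Its [B12] frame IS the frame of record** (`rfl`; the [B13] substitution leaves the [B12] fields, `XB13OfRecord_F12`). [cite: Balaban1987RG1, Lemma 4 (3.53) p.280 (objects of record)] -/
theorem Stage13Params.pinX3P₂D_F12 (P : B12.RunParams) :
    ((θ.pinX3P₂D F N lam8 lam12 lam13).res.X P).F12 = F12OfRecord₁₂ F N θ.toStage12Params lam12 P := rfl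

/-- **Its [B12] constants ARE the layer's** (`rfl`). [cite: Balaban1987RG1, Lemma 4 p.280 (bookkeeping)] -/
theorem Stage13Params.pinX3P₂D_c12 (P : B12.RunParams) : ((θ.pinX3P₂D F N lam8 lam12 lam13).res.X P).c12 = (lam12 P).consts := rfl

/-- The pin touches neither the Stage-3 dictionary (`rfl`) … [cite: Balaban1984PropagatorsII, pp.223–250 (bookkeeping)] -/
theorem Stage13Params.pinX3P₂D_toStage3Params : (θ.pinX3P₂D F N lam8 lam12 lam13).toStage3Params = θ.toStage3Params :=
  Stage13Params.rebindX_toStage3Params F N θ _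

/-- … nor anything but `res.X` of the Stage-12 part (`rfl`: it IS the Stage-12 re-binding lifted) … [cite: Balaban1988Convergent, p.244 (bookkeeping)] -/
theorem Stage13Params.pinX3P₂D_toStage12Params :
    (θ.pinX3P₂D F N lam8 lam12 lam13).toStage12Params = θ.toStage12Params.rebindX F N (XPinned₁₃P₂D F N θ lam8 lam12 lam13) :=
  Stage13Params.rebindX_toStage12Params F N θ _

/-- … nor the block size and the interval letter (`rfl` ×2) … [cite: Balaban1987RG1, (0.1) p.250; Balaban1989LargeFieldII, Thm 1 p.355 (bookkeeping)] -/
theorem Stage13Params.pinX3P₂D_L_γ : (θ.pinX3P₂D F N lam8 lam12 lam13).L = θ.L ∧ (θ.pinX3P₂D F N lam8 lam12 lam13).γ = θ.γ :=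
  Stage13Params.rebindX_L_γ F N θ _

/-- … nor the (2.9) letter `ε₂₉` (`rfl`) … [cite: Balaban1987RG1, (2.9) p.266 (bookkeeping)] -/
theorem Stage13Params.pinX3P₂D_ε₂₉ : (θ.pinX3P₂D F N lam8 lam12 lam13).ε₂₉ = θ.ε₂₉ := Stage13Params.rebindX_ε₂₉ F N θ _

/-- … nor the Y ∕ Z ∕ W residual layers (`rfl` ×3). [cite: Balaban1985BackgroundPropagators, Thm 3.1 p.397; Balaban1985Variational, Thm 1 p.279; Balaban1989LargeFieldI, (0.2) p.176 (bookkeeping)] -/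
theorem Stage13Params.pinX3P₂D_res_Y_Z_W :
    (θ.pinX3P₂D F N lam8 lam12 lam13).res.Y = θ.res.Y ∧ (θ.pinX3P₂D F N lam8 lam12 lam13).res.Z = θ.res.Z ∧ (θ.pinX3P₂D F N lam8 lam12 lam13).res.W = θ.res.W :=
  Stage13Params.rebindX_res_Y_Z_W F N θ _

/-- **Admissibility is read at `θ`** (`Iff.rfl`, `rebindX_admissible_iff`). [cite: Balaban1987RG1, (1.20)–(1.21) p.264 (hypothesis dictionary; bookkeeping)] -/
theorem Stage13Params.pinX3P₂D_admissible_iff : (θ.pinX3P₂D F N lam8 lam12 lam13).Admissible F N ↔ θ.Admissible F N :=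
  Stage13Params.rebindX_admissible_iff F N θ _

/-- **The rev-16 guard is read at `θ`** (`Iff.rfl`, `guard_rebindX_iff`). [cite: Balaban1988Convergent, (3.16)–(3.22) pp.268–269; Balaban1989LargeFieldI, (0.3) p.176 (bookkeeping)] -/
theorem Stage13Params.pinX3P₂D_guard_iff :
    ((θ.pinX3P₂D F N lam8 lam12 lam13).ZtUnity F N ∧ (θ.pinX3P₂D F N lam8 lam12 lam13).SlotsNondegenerate₁₃ F N) ↔ (θ.ZtUnity F N ∧ θ.SlotsNondegenerate₁₃ F N) :=
  Stage13Params.guard_rebindX_iff F N θ _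

/-- The Stage-13 view of the pinned parameter IS the re-bound Stage-13 view (`toStage5₁₃_rebindX`). [cite: Balaban1988Convergent, p.244 (bookkeeping)] -/
theorem Stage13Params.toStage5₁₃_pinX3P₂D :
    (θ.pinX3P₂D F N lam8 lam12 lam13).toStage5₁₃ F N = (θ.toStage5₁₃ F N).rebindX F N (XPinned₁₃P₂D F N θ lam8 lam12 lam13) :=
  Stage13Params.toStage5₁₃_rebindX F N θ _

/-- **The seven ₁₃ objects every θ-keyed child engine reads are `θ`'s** (`rfl` ×7 through the generic faces): couplings, β, the (2.9) χ-slot, the effective actions, the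
densities, the §2-format law, the 𝐓-image law. [cite: Balaban1987RG1, (1.22) p.264, (2.9) p.266; Balaban1988Convergent, (0.2) p.244, (2.18) p.257 (bookkeeping)] -/
theorem Stage13Params.pinX3P₂D_histories :
    gOfRecord₁₃ F N (θ.pinX3P₂D F N lam8 lam12 lam13) = gOfRecord₁₃ F N θ ∧ betaOfRecord₁₃ F N (θ.pinX3P₂D F N lam8 lam12 lam13) = betaOfRecord₁₃ F N θ ∧
      chiβOfRecord₁₃ F N (θ.pinX3P₂D F N lam8 lam12 lam13) = chiβOfRecord₁₃ F N θ ∧ EOfRecord₁₃ F N (θ.pinX3P₂D F N lam8 lam12 lam13) = EOfRecord₁₃ F N θ ∧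
        densOfRecord₁₃ F N (θ.pinX3P₂D F N lam8 lam12 lam13) = densOfRecord₁₃ F N θ ∧ SLaw₁₃ F N (θ.pinX3P₂D F N lam8 lam12 lam13) = SLaw₁₃ F N θ ∧
          TLaw₁₃ F N (θ.pinX3P₂D F N lam8 lam12 lam13) = TLaw₁₃ F N θ :=
  ⟨gOfRecord₁₃_rebindX F N θ _, betaOfRecord₁₃_rebindX F N θ _, chiβOfRecord₁₃_rebindX F N θ _, EOfRecord₁₃_rebindX F N θ _, densOfRecord₁₃_rebindX F N θ _,
    (SLaw₁₃_TLaw₁₃_rebindX F N θ _).1, (SLaw₁₃_TLaw₁₃_rebindX F N θ _).2⟩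

/-- The [IV] bundle of record is unchanged (`WOfRecord₁₃_pins`, first conjunct). [cite: Balaban1989LargeFieldI, (0.2) p.176 (bookkeeping)] -/
theorem WOfRecord₁₃_pinX3P₂D (lamW : ResidW F N) : WOfRecord₁₃ F N (θ.pinX3P₂D F N lam8 lam12 lam13) lamW = WOfRecord₁₃ F N θ lamW :=
  (WOfRecord₁₃_pins F N θ _ (fun P => θ.res.W P) lam8 lam12 lamW).1

/-- The [B12] frame of record is unchanged (`F12OfRecord₁₂_stage13_pins`, first conjunct). [cite: Balaban1987RG1, Lemma 4 (3.53) p.280 (bookkeeping)] -/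
theorem F12OfRecord₁₂_pinX3P₂D (lam : ResidB12 F N θ.τ9.M) (p : B12.RunParams) :
    F12OfRecord₁₂ F N (θ.pinX3P₂D F N lam8 lam12 lam13).toStage12Params lam p = F12OfRecord₁₂ F N θ.toStage12Params lam p :=
  (F12OfRecord₁₂_stage13_pins F N θ _ lam8 lam lam12 p).1

end PinX3


/-! ## §2. The three X-reading sockets of the K1 engine READ AT THE P₂D-PINNED PARAMETER (`Iff.rfl`; N05 typed over the δ₂-members of the (1.5)-obeying sub-index `IdxB8SubD`, N09 ∕ N10 as before) -/

section Sockets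

variable (θ : Stage13Params F N) (lam8 : ResidB8 θ.toStage3Params) (lam12 : ResidB12 F N θ.τ9.M)
  (lam13 : B12.RunParams → ResidB13 θ.toStage3Params) (P : B12.RunParams)

/-- **N05's TYPED SOCKET AT THE P-PINNED PARAMETER IS THE TYPED [B8″P] LEAF OVER THE P-MEMBERS AT `lam8`** (`Iff.rfl`: the fifteen [B8] fields of `XPinned₁₃P₂D … P` are
`withB8OfRecordSubBP₂D`'s — the same right-hand side as `CarriersB8SubBP.b8LeafR_withB8OfRecordSubBP₂D_iff`; typed ⇒ surviving by `CarriersB8SubBP.b8LeafOfRecordSubBP_of_b8LeafR` —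
the knits of record serve the SURVIVING form, §2b).
[cite: Balaban1985RegularSpaces, Lemma 1 p.79 – Thm 8 p.101 (the leaf at the objects of record)] -/
theorem socket05_pinX3P₂D_iff :
    B8LeafR ((θ.pinX3P₂D F N lam8 lam12 lam13).res.X P).d8 ((θ.pinX3P₂D F N lam8 lam12 lam13).res.X P).L8 ((θ.pinX3P₂D F N lam8 lam12 lam13).res.X P).C₂
        ((θ.pinX3P₂D F N lam8 lam12 lam13).res.X P).B₁' ((θ.pinX3P₂D F N lam8 lam12 lam13).res.X P).B₀' ((θ.pinX3P₂D F N lam8 lam12 lam13).res.X P).B₁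
        ((θ.pinX3P₂D F N lam8 lam12 lam13).res.X P).B₂ ((θ.pinX3P₂D F N lam8 lam12 lam13).res.X P).c₁ ((θ.pinX3P₂D F N lam8 lam12 lam13).res.X P).inp8
        ((θ.pinX3P₂D F N lam8 lam12 lam13).res.X P).B₀β ((θ.pinX3P₂D F N lam8 lam12 lam13).res.X P).loc8 ((θ.pinX3P₂D F N lam8 lam12 lam13).res.X P).fam8R
        ((θ.pinX3P₂D F N lam8 lam12 lam13).res.X P).lan8 ((θ.pinX3P₂D F N lam8 lam12 lam13).res.X P).cub8 ((θ.pinX3P₂D F N lam8 lam12 lam13).res.X P).toAxial8 ↔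
      B8LeafR θ.D (θ.L : ℝ) lam8.C₂ lam8.B₁' lam8.inp.B₀' lam8.B₁ lam8.B₂ lam8.c₁ lam8.inp lam8.B₀β (B8Lemma1NonAbelian.blockPairNA θ.D θ.L θ.𝔸)
        (fun j : IdxB8SubD θ.toStage3Params => famB8OfRecordSubBP₂D θ.toStage3Params lam8.β lam8.len j) lam8.lan lam8.cub
        (fun j => toAxialTowerResid θ.toStage3Params lam8.β lam8.len j.1.1.1) :=
  Iff.rfl

/-- **N09's SOCKET AT THE PINNED PARAMETER IS LEMMA 4 AS PRINTED AT THE [B12] FRAME OF RECORD** (`Iff.rfl`). [cite: Balaban1987RG1, Lemma 4 p.280, (3.53)–(3.54) pp.280–285 (the leaf at the objects of record)] -/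
theorem socket09_pinX3P₂D_iff :
    B12Sec2to5.Lemma4Printed ((θ.pinX3P₂D F N lam8 lam12 lam13).res.X P).F12 ((θ.pinX3P₂D F N lam8 lam12 lam13).res.X P).c12 ↔
      B12Sec2to5.Lemma4Printed (F12OfRecord₁₂ F N θ.toStage12Params lam12 P) (lam12 P).consts :=
  Iff.rfl

/-- **N10's SOCKET AT THE PINNED PARAMETER IS THE [B13] LEAF AT THE GROUP OF RECORD** (`Iff.rfl`). [cite: Balaban1988RG2Cluster, Lemma 1 p.9, Lemma 2 p.11, Lemma 3 p.20 (the leaf at the objects of record)] -/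
theorem socket10_pinX3P₂D_iff :
    (B13.Lemma1Printed ((θ.pinX3P₂D F N lam8 lam12 lam13).res.X P).S13 ((θ.pinX3P₂D F N lam8 lam12 lam13).res.X P).c13 ∧
        B13.Lemma2Printed ((θ.pinX3P₂D F N lam8 lam12 lam13).res.X P).S13 ((θ.pinX3P₂D F N lam8 lam12 lam13).res.X P).c13 ∧
          B13.Lemma3Printed ((θ.pinX3P₂D F N lam8 lam12 lam13).res.X P).S13 ((θ.pinX3P₂D F N lam8 lam12 lam13).res.X P).c13) ↔
      B13LeafOfRecord θ.toStage3Params (lam13 P) :=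
  Iff.rfl

variable {P} in
/-- **N10's socket of module 40 in its full binder shape at the pinned parameter, from the leaf** (the in-edge antecedents are not needed once the leaf is given).
[cite: Balaban1988RG2Cluster, Lemmas 1–3 pp.9, 11, 20 (the node at the objects of record)] -/
theorem socket10_pinX3P₂D_of_leafOfRecord (hleaf : ∀ P, B13LeafOfRecord θ.toStage3Params (lam13 P)) (Mstar : ℕ)
    (ops : OpsY N (θ.pinX3P₂D F N lam8 lam12 lam13).toStage3Params Mstar) (ζ : ResidZ F N) (lamW : ResidW F N) :
    ∀ P : B12.RunParams, B9LeafX (Y9OfRecord N (θ.pinX3P₂D F N lam8 lam12 lam13).toStage3Params Mstar ops) →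
      (B10.Thm1PrintedCompact (((θ.pinX3P₂D F N lam8 lam12 lam13).view₁₃B10YZW F N Mstar ops ζ lamW).res.X P).runs10 ∧
          B10.Thm2Printed (((θ.pinX3P₂D F N lam8 lam12 lam13).view₁₃B10YZW F N Mstar ops ζ lamW).res.X P).runs10) →
        B11Leaf (Z11OfRecord F N ζ) →
          B12Sec2to5.Lemma4Printed ((θ.pinX3P₂D F N lam8 lam12 lam13).res.X P).F12 ((θ.pinX3P₂D F N lam8 lam12 lam13).res.X P).c12 →
          B13.Lemma1Printed ((θ.pinX3P₂D F N lam8 lam12 lam13).res.X P).S13 ((θ.pinX3P₂D F N lam8 lam12 lam13).res.X P).c13 ∧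
            B13.Lemma2Printed ((θ.pinX3P₂D F N lam8 lam12 lam13).res.X P).S13 ((θ.pinX3P₂D F N lam8 lam12 lam13).res.X P).c13 ∧
              B13.Lemma3Printed ((θ.pinX3P₂D F N lam8 lam12 lam13).res.X P).S13 ((θ.pinX3P₂D F N lam8 lam12 lam13).res.X P).c13 :=
  fun P _ _ _ _ => hleaf P

end Sockets

/-! ## §3 (H). THE H-LIFT OF THE P-PIN AT THE v1.7 `CoPH` KEY: `Stage13HParams.pinX3P₂D` — ONE H-level re-binding (dag-n10-d's `Stage13HParams.rebindX`); faces, laws, provisos, datums -/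

section PinX3PH

variable (θ : Stage13HParams F N) (lam8 : ResidB8 θ.toStage3Params) (lam12 : ResidB12 F N θ.τ9.M)
  (lam13 : B12.RunParams → ResidB13 θ.toStage3Params)

/-- **The one-level X-pin AT THE «P₂D» PIN of the v1.7 Stage-13 parameters** (history-indexed residual 𝐓-weight slot `Zh` untouched): ONE H-level `rebindX` over `XPinned₁₃P₂D
θ.toStage13Params lam8 lam12 lam13` — the P₂D-twin of `Stage13HParams.pinX3P₂C` ∕ `Stage13HParams.pinX3P` ∕ dag-n10-d's `Stage13HParams.pinX3H` (`Record13CarriersCoPH` §0).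
[cite: Balaban1985RegularSpaces, Thm 2 p.83, Thm 8 (1.146) p.101; Balaban1988Convergent, p.244 (bookkeeping presentation)] -/
def Stage13HParams.pinX3P₂D : Stage13HParams F N := θ.rebindX F N (XPinned₁₃P₂D F N θ.toStage13Params lam8 lam12 lam13)

/-- Unfolding (`rfl`). [cite: Balaban1988Convergent, p.244 (bookkeeping)] -/
theorem Stage13HParams.pinX3P₂D_eq_rebindX : θ.pinX3P₂D F N lam8 lam12 lam13 = θ.rebindX F N (XPinned₁₃P₂D F N θ.toStage13Params lam8 lam12 lam13) := rfl

/-- Its Stage-13 part IS the θ-level P-pin, and the history-indexed residual is kept (`rfl` ×2). [cite: Balaban1988Convergent, p.244 (bookkeeping)] -/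
theorem Stage13HParams.pinX3P₂D_toStage13Params :
    (θ.pinX3P₂D F N lam8 lam12 lam13).toStage13Params = θ.toStage13Params.pinX3P₂D F N lam8 lam12 lam13 ∧ (θ.pinX3P₂D F N lam8 lam12 lam13).Zh = θ.Zh :=
  Stage13HParams.rebindX_toStage13Params F N θ _

/-- The pinned carrier family IS the combined map; the Stage-3 dictionary, `L`, `γ`, `ε₂₉` and the `Y ∕ Z ∕ W` layers are kept (`rfl` ×7, `rebindX_faces`). [cite: Balaban1988Convergent, p.244 (bookkeeping)] -/
theorem Stage13HParams.pinX3P₂D_faces (P : B12.RunParams) :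
    (θ.pinX3P₂D F N lam8 lam12 lam13).res.X P = XPinned₁₃P₂D F N θ.toStage13Params lam8 lam12 lam13 P ∧ (θ.pinX3P₂D F N lam8 lam12 lam13).toStage3Params = θ.toStage3Params ∧
      (θ.pinX3P₂D F N lam8 lam12 lam13).L = θ.L ∧ (θ.pinX3P₂D F N lam8 lam12 lam13).γ = θ.γ ∧ (θ.pinX3P₂D F N lam8 lam12 lam13).ε₂₉ = θ.ε₂₉ ∧
        (θ.pinX3P₂D F N lam8 lam12 lam13).res.Y = θ.res.Y ∧ ((θ.pinX3P₂D F N lam8 lam12 lam13).res.Z = θ.res.Z ∧ (θ.pinX3P₂D F N lam8 lam12 lam13).res.W = θ.res.W) :=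
  Stage13HParams.rebindX_faces F N θ _ P

/-- **Admissibility is read at `θ`** (`rebindX_admissible_iff`). [cite: Balaban1987RG1, (1.20)–(1.21) p.264 (hypothesis dictionary; bookkeeping)] -/
theorem Stage13HParams.pinX3P₂D_admissible_iff : (θ.pinX3P₂D F N lam8 lam12 lam13).Admissible F N ↔ θ.Admissible F N :=
  Stage13HParams.rebindX_admissible_iff F N θ _

/-- **The ⁷ guard is read at `θ`** (`guard_rebindX_iff`). [cite: Balaban1988Convergent, (3.16)–(3.22) pp.268–269; Balaban1989LargeFieldI, (0.3) p.176 (bookkeeping)] -/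
theorem Stage13HParams.pinX3P₂D_guard_iff :
    ((θ.pinX3P₂D F N lam8 lam12 lam13).ZhUnity F N ∧ (θ.pinX3P₂D F N lam8 lam12 lam13).SlotsNondegenerate₁₃ F N) ↔ (θ.ZhUnity F N ∧ θ.SlotsNondegenerate₁₃ F N) :=
  Stage13HParams.guard_rebindX_iff F N θ _

variable {F N θ} in
/-- The v1.7 bg-free core provisos transport along the P-pin (`Provisos₁₃CoPH.rebindX`). [cite: Balaban1988Convergent, (2.18) p.257, (3.2)–(3.9) pp.265–266 (bookkeeping)] -/
theorem Stage13HParams.Provisos₁₃CoPH.pinX3P₂D (h : θ.Provisos₁₃CoPH F N) : (θ.pinX3P₂D F N lam8 lam12 lam13).Provisos₁₃CoPH F N :=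
  h.rebindX _

/-- The v1.7 Stage-13 view of the P-pinned parameter IS the re-bound v1.7 view (`toStage5₁₃CoPH_rebindX`). [cite: Balaban1988Convergent, p.244, (2.12)–(2.13) pp.256–257 (bookkeeping)] -/
theorem Stage13HParams.toStage5₁₃CoPH_pinX3P₂D :
    (θ.pinX3P₂D F N lam8 lam12 lam13).toStage5₁₃CoPH F N = (θ.toStage5₁₃CoPH F N).rebindX F N (XPinned₁₃P₂D F N θ.toStage13Params lam8 lam12 lam13) :=
  Stage13HParams.toStage5₁₃CoPH_rebindX F N θ _

/-- The two background-reading laws at the P-pinned parameter are `θ`'s (`SLaw₁₃CoPH_TLaw₁₃CoPH_rebindX`). [cite: Balaban1988Convergent, (2.18) p.257 (bookkeeping)] -/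
theorem Stage13HParams.pinX3P₂D_lawsCoPH :
    SLaw₁₃CoPH F N (θ.pinX3P₂D F N lam8 lam12 lam13) = SLaw₁₃CoPH F N θ ∧ TLaw₁₃CoPH F N (θ.pinX3P₂D F N lam8 lam12 lam13) = TLaw₁₃CoPH F N θ :=
  SLaw₁₃CoPH_TLaw₁₃CoPH_rebindX F N θ _

variable {F N θ} in
/-- The v1.7 separated-range provisos transport along the P-pin (`Provisos₁₃SepCoPH.rebindX`, dag-n10-d). [cite: Balaban1988Convergent, (2.23)–(2.42) pp.259–262; Balaban1985RegularSpaces, (1.3)–(1.9) pp.76–77 (bookkeeping)] -/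
theorem Stage13HParams.Provisos₁₃SepCoPH.pinX3P₂D (h : θ.Provisos₁₃SepCoPH F N) : (θ.pinX3P₂D F N lam8 lam12 lam13).Provisos₁₃SepCoPH F N :=
  h.rebindX _

/-- UP-SIDE (v1.7 core): the datum is `θ`'s (`datumOfRecord₁₃CoPH_rebindX`). [cite: Balaban1989LargeFieldII, Thm 1 + (0.1) pp.355–356 (bookkeeping)] -/
theorem datumOfRecord₁₃CoPH_pinX3P₂D (h : θ.Provisos₁₃CoPH F N) :
    datumOfRecord₁₃CoPH F N (θ.pinX3P₂D F N lam8 lam12 lam13) (h.pinX3P₂D lam8 lam12 lam13) = datumOfRecord₁₃CoPH F N θ h :=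
  datumOfRecord₁₃CoPH_rebindX F N θ h _ _

/-- UP-SIDE (v1.7 separated range): the datum of record is `θ`'s (`datumOfRecord₁₃SepCoPH_rebindX`). [cite: Balaban1989LargeFieldII, Thm 1 + (0.1) pp.355–356 (bookkeeping)] -/
theorem datumOfRecord₁₃SepCoPH_pinX3P₂D (h : θ.Provisos₁₃SepCoPH F N) :
    datumOfRecord₁₃SepCoPH F N (θ.pinX3P₂D F N lam8 lam12 lam13) (h.pinX3P₂D lam8 lam12 lam13) = datumOfRecord₁₃SepCoPH F N θ h :=
  datumOfRecord₁₃SepCoPH_rebindX F N θ h _ _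

end PinX3PH

/-! ## §4. N05's socket IN THE REPAIRED CURRENCY at the P₂D-pinned v1.7 view (dag-n05-w1's SC-binding `upOfRecord₅CSC … (c₇OfRecord θ₃)`) = the «P₂D» SLOT the knits of record serve -/

section SocketSC

variable (θ : Stage13HParams F N) (lam8 : ResidB8 θ.toStage3Params) (lam12 : ResidB12 F N θ.τ9.M)
  (lam13 : B12.RunParams → ResidB13 θ.toStage3Params) (P : B12.RunParams)

/-- ★ **THE `b8` LEAF OF THE SC-BINDING OVER THE P₂D-PINNED v1.7 VIEW IS THE «P₂D» SLOT `B8LeafOfRecordSubBP₂D θ₃ lam8`** (`Iff.rfl`) — the conclusion shape of dag-n05-d's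
re-keyed «P₂D» knits (`Thm/BalabanUVNodesN05SubBP2DKnitGammaPrime{,ZdLan,PrintCube,PrintCubeZdLan}`, `…SubBP2DT8SrvGammaPrime`) at the cut layers; Proposition 7 is SERVED inside that slot.
[cite: Balaban1985RegularSpaces, Lemma 1 – Thm 8 pp.79–101, Prop. 7 (1.144)–(1.145) p.100, Thm 8 (1.146) p.101 (the slot in the repaired currency)] -/
theorem socket05SC_toStage5₁₃CoPH_pinX3P₂D_iff :
    (upOfRecord₅CSC F N ((θ.pinX3P₂D F N lam8 lam12 lam13).toStage5₁₃CoPH F N) (c₇OfRecord θ.toStage3Params) P).b8 ↔ B8LeafOfRecordSubBP₂D θ.toStage3Params lam8 :=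
  Iff.rfl

/-- The C-binding's `b8` over the P₂D-pinned v1.7 view is the TYPED [B8″P₂D] leaf (`Iff.rfl`; = `socket05_pinX3P₂D_iff`'s reading at that view).
[cite: Balaban1985RegularSpaces, Lemma 1 – Thm 8 pp.79–101 (bookkeeping)] -/
theorem socket05_toStage5₁₃CoPH_pinX3P₂D_iff :
    (upOfRecord₅C F N ((θ.pinX3P₂D F N lam8 lam12 lam13).toStage5₁₃CoPH F N) P).b8 ↔
      B8LeafR θ.D (θ.L : ℝ) lam8.C₂ lam8.B₁' lam8.inp.B₀' lam8.B₁ lam8.B₂ lam8.c₁ lam8.inp lam8.B₀β (B8Lemma1NonAbelian.blockPairNA θ.D θ.L θ.𝔸)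
        (fun j : IdxB8SubD θ.toStage3Params => famB8OfRecordSubBP₂D θ.toStage3Params lam8.β lam8.len j) lam8.lan lam8.cub
        (fun j => toAxialTowerResid θ.toStage3Params lam8.β lam8.len j.1.1.1) :=
  Iff.rfl

/-- TYPED ⇒ RS ⇒ THE SLOT at the P₂D-pinned view (`B8LeafKnitRS.b8LeafRS_of_b8LeafR` under `C136_C162_famB8OfRecordSubBP₂D`, then dag-n05-w1's
`b8LeafOfRecordSubBP₂D_of_b8LeafRS_pinned` at `2 ≤ c₇OfRecord θ₃`, `1 ≤ θ.D` from admissibility): the C-binding's `b8` implies the SC-binding's; never conversely.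
[cite: Balaban1985RegularSpaces, Thm 8 p.101, Prop. 7 (1.145) p.100, (1.36) p.82, (1.62) p.87 (bookkeeping)] -/
theorem b8SC_of_b8_toStage5₁₃CoPH_pinX3P₂D (hθ : θ.Admissible F N) (h : (upOfRecord₅C F N ((θ.pinX3P₂D F N lam8 lam12 lam13).toStage5₁₃CoPH F N) P).b8) :
    (upOfRecord₅CSC F N ((θ.pinX3P₂D F N lam8 lam12 lam13).toStage5₁₃CoPH F N) (c₇OfRecord θ.toStage3Params) P).b8 :=
  b8LeafOfRecordSubBP₂D_of_b8LeafRS_pinned (le_trans one_le_two (hθ.toStage9.toStage8).1.1.1.1) lam8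
    (B8LeafKnitRS.b8LeafRS_of_b8LeafR (C136_C162_famB8OfRecordSubBP₂D lam8.β lam8.len) h)

/-- The other leaves of the SC-binding over the P₂D-pinned v1.7 view are the C-binding's (`rfl` ×5). [cite: Balaban1989LargeFieldII, Thm 1 p.355 (bookkeeping)] -/
theorem upOfRecord₅CSC_toStage5₁₃CoPH_pinX3P₂D_offB8 :
    (upOfRecord₅CSC F N ((θ.pinX3P₂D F N lam8 lam12 lam13).toStage5₁₃CoPH F N) (c₇OfRecord θ.toStage3Params) P).b9 =
      (upOfRecord₅C F N ((θ.pinX3P₂D F N lam8 lam12 lam13).toStage5₁₃CoPH F N) P).b9 ∧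
    (upOfRecord₅CSC F N ((θ.pinX3P₂D F N lam8 lam12 lam13).toStage5₁₃CoPH F N) (c₇OfRecord θ.toStage3Params) P).b10 =
      (upOfRecord₅C F N ((θ.pinX3P₂D F N lam8 lam12 lam13).toStage5₁₃CoPH F N) P).b10 ∧
    (upOfRecord₅CSC F N ((θ.pinX3P₂D F N lam8 lam12 lam13).toStage5₁₃CoPH F N) (c₇OfRecord θ.toStage3Params) P).b11 =
      (upOfRecord₅C F N ((θ.pinX3P₂D F N lam8 lam12 lam13).toStage5₁₃CoPH F N) P).b11 ∧
    (upOfRecord₅CSC F N ((θ.pinX3P₂D F N lam8 lam12 lam13).toStage5₁₃CoPH F N) (c₇OfRecord θ.toStage3Params) P).b12 =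
      (upOfRecord₅C F N ((θ.pinX3P₂D F N lam8 lam12 lam13).toStage5₁₃CoPH F N) P).b12 ∧
    (upOfRecord₅CSC F N ((θ.pinX3P₂D F N lam8 lam12 lam13).toStage5₁₃CoPH F N) (c₇OfRecord θ.toStage3Params) P).rBasicStep =
      (upOfRecord₅C F N ((θ.pinX3P₂D F N lam8 lam12 lam13).toStage5₁₃CoPH F N) P).rBasicStep :=
  ⟨rfl, rfl, rfl, rfl, rfl⟩

end SocketSC

/-! ## §5. The v1.7 records presented at the P-pinned parameter (instances of dag-n10-d's generic re-binding records) -/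

section Records

variable {F N}

/-- A world with def-T's pointed clauses bound over the v1.7 view OF THE P₂D-PINNED PARAMETER is a v1.7 core record at `θ`'s datum (`isRecordOfRecord₁₃CCoPH_rebindX_of_eq`).
[cite: Balaban1989LargeFieldII, Thm 1 + (0.1) pp.355–356 (bookkeeping)] -/
theorem isRecordOfRecord₁₃CCoPH_pinX3P₂D_of_eq (θ : Stage13HParams F N) (h : θ.Provisos₁₃CoPH F N) (hθ : θ.Admissible F N) (lam8 : ResidB8 θ.toStage3Params)
    (lam12 : ResidB12 F N θ.τ9.M) (lam13 : B12.RunParams → ResidB13 θ.toStage3Params) (w : WorldP) (hC : w.C = (datumOfRecord₁₃CoPH F N θ h).C)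
    (hγ : 0 < w.γ ∧ w.γ ≤ θ.γ) (hL : w.L = (θ.L : ℝ)) (hup : ∀ P, w.up P = upOfRecord₅C F N ((θ.pinX3P₂D F N lam8 lam12 lam13).toStage5₁₃CoPH F N) P) :
    IsRecordOfRecord₁₃CCoPH F N (datumOfRecord₁₃CoPH F N θ h) w :=
  isRecordOfRecord₁₃CCoPH_rebindX_of_eq F N θ h hθ _ w hC hγ hL hup

/-- … and a v1.7 separated-range record (`isRecordOfRecord₁₃CSepCoPH_rebindX_of_eq`). [cite: Balaban1989LargeFieldII, Thm 1 + (0.1) pp.355–356 (bookkeeping)] -/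
theorem isRecordOfRecord₁₃CSepCoPH_pinX3P₂D_of_eq (θ : Stage13HParams F N) (h : θ.Provisos₁₃SepCoPH F N) (hθ : θ.Admissible F N) (lam8 : ResidB8 θ.toStage3Params)
    (lam12 : ResidB12 F N θ.τ9.M) (lam13 : B12.RunParams → ResidB13 θ.toStage3Params) (w : WorldP) (hC : w.C = (datumOfRecord₁₃SepCoPH F N θ h).C)
    (hγ : 0 < w.γ ∧ w.γ ≤ θ.γ) (hL : w.L = (θ.L : ℝ)) (hup : ∀ P, w.up P = upOfRecord₅C F N ((θ.pinX3P₂D F N lam8 lam12 lam13).toStage5₁₃CoPH F N) P) :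
    IsRecordOfRecord₁₃CSepCoPH F N (datumOfRecord₁₃SepCoPH F N θ h) w :=
  isRecordOfRecord₁₃CSepCoPH_rebindX_of_eq F N θ h hθ _ w hC hγ hL hup

/-- Every admissible Stage-13 parameter with the v1.7 provisos presents a v1.7 record of its own datum over the P₂D-pinned v1.7 view, any window, block size `θ.L`
(`exists_world_isRecordOfRecord₁₃CSepCoPH_rebindX`). [cite: Balaban1989LargeFieldII, Thm 1 + (0.1) pp.355–356 (bookkeeping)] -/
theorem exists_world_isRecordOfRecord₁₃CSepCoPH_pinX3P₂D (θ : Stage13HParams F N) (h : θ.Provisos₁₃SepCoPH F N) (hθ : θ.Admissible F N)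
    (lam8 : ResidB8 θ.toStage3Params) (lam12 : ResidB12 F N θ.τ9.M) (lam13 : B12.RunParams → ResidB13 θ.toStage3Params) {γw : ℝ} (hγw : 0 < γw ∧ γw ≤ θ.γ) :
    ∃ w : WorldP, IsRecordOfRecord₁₃CSepCoPH F N (datumOfRecord₁₃SepCoPH F N θ h) w ∧ w.γ = γw ∧ w.L = (θ.L : ℝ) ∧
      ∀ P, w.up P = upOfRecord₅C F N ((θ.pinX3P₂D F N lam8 lam12 lam13).toStage5₁₃CoPH F N) P :=
  exists_world_isRecordOfRecord₁₃CSepCoPH_rebindX F N θ h hθ _ hγw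

end Records


end Literature.MathematicalPhysics.QuantumFieldTheory.Balaban1983to89.Node00

end
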